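import Summits.ABC.ABC.Theorems.PadicPrimesYuNinetyThreeModFourTransfer
import Literature.NumberTheory.Transcendental.MahlerManinEndgame
import HarnessLib

set_option linter.dupNamespace false

/-!
# Route PadicPrimesYuNinety under PATH Z: the transfer from the WALDSCHMIDT-SHAPE twist engine
# (`(W + log 2Vmax)·log 2Vmax`, p2-g2 memo-04 "EngineOddW80") to the Waldschmidt-shape rational-prime
# text `(c₅ #S)^{#S} · p² · (log B + log log A) · log log A · ∏ log max(4,q)`

`Summits/ABC/StewartYu/YuNinetyW80Transfer.lean` — cell `abc-stewartyu` (HOME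
`run/shared/lean/pub/abc-stewartyu/`, seat p3 (g2); theorems only, no definition, no named fact),
sibling of `Summits/ABC/ABC/Theorems/PadicPrimesYuNinety{ThreeModFour,OddEngine,FlooredEngine}Transfer.lean`.

Context (HOME/p2/memo-04-Y3-shape-and-plan.md §1–§3; HOME/p3/memo-03): an engine built on the cell's
LANDED Waldschmidt-1980 architecture, run in `log p` units with the Teichmüller twist, outputs for
rational `p`-adic units `ord_p(∏ αⱼ^{bⱼ} − 1) ≤ C(m)·p·∏(Vⱼ/log p)·(W + log(2Vmax))·log(2Vmax)`
(`C(m) ≤ c₁^m m^m`, floors `log p ≤ Vⱼ ≤ Vmax`, `log p ≤ W`) — not Yu's product `W·log V`. This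
shape still transfers to the Waldschmidt-shape text
`ord_p(∏_{q∈S} q^{e_q} − 1) < (c₅ #S)^{#S}·p²·(log B + log log A)·log log A·∏ log max(4,q)`
(`A = max(4, max S)`, `c₅ = 41c₁`), which feeds (a) the κ-door slot `FinBoundAt p K L 1 2 1 2` (rung
A1.M2⁻, `EpsShapeBoundOne`; sequel file) and (b) the RESTRICTED Stewart–Yu door
`Literature.Barriers.ABC.stewartYu1991_of_w80Shape` (p3's `BakerMethodBoundsStewartYu1991LineRestrictedProofs`):
rung A1.M2, `rad^{2/3+ε}`. Bookkeeping = p1's transfer with the new garbage: `αⱼ = qⱼ`,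
`Vⱼ = log p·log max(4,qⱼ)`, `Vmax = log p·X` (`X = log A`), `W = log B·log p`;
`log(2Vmax) ≤ log p + log X ≤ log p·(1 + log X)`, `W + log(2Vmax) ≤ log p·(log B + 1 + log X) ≤ 2 log p·(log B + log X)`,
`1 + log X ≤ 5 log X` (`log X ≥ 0.27`), `(log p)² ≤ 4p` (the tree's `log_sq_le_four_mul`): the crux's spare factor `p`
pays the `(log p)²`. Generic in a residue predicate `P` with `¬ P 2` (instances for `3`, `1 (mod 4)` and
all odd `p`). Everything is [folklore]. WHAT THIS IS NOT: no engine is proved; the Waldschmidt-shape texts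
are not (yet) route declarations — under the planner's option (i) they become the cruxes and these theorems
their `stub_transfer`s.
-/

noncomputable section

open Finset Real Height

namespace Summit.ABC.StewartYu

namespace YuNinetyW80

open Summit.ABC.ABC.Theorems

/-- **Generic residue-class transfer, Waldschmidt-shape engine.** For a predicate `P` on primes with
`¬ P 2`: an engine bound `ord_p(∏ αⱼ^{bⱼ} − 1) ≤ C(m)·p·∏(Vⱼ/log p)·(W + log 2Vmax)·log 2Vmax`
(`C(m) ≤ c₁^m m^m`; floors `log p ≤ Vⱼ ≤ Vmax`, `log p ≤ W`) for rational `p`-adic units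
(multiplicatively independent, no signed sub-product a square) at every prime with `P p` gives, at
every prime with `P p`, the Waldschmidt-shape rational-prime text with `c₅ = 41c₁`:
`ord_p(∏_{q∈S} q^{e_q} − 1) < (c₅ #S)^{#S}·p²·(log B + log log A)·log log A·∏ log max(4,q)`.
[folklore] -/
theorem residueClass_of_w80Engine (P : ℕ → Prop) (hP2 : ¬ P 2)
    (hE : ∃ (C : ℕ → ℝ) (c₁ : ℝ), 1 ≤ c₁ ∧ (∀ m, 0 ≤ C m ∧ C m ≤ c₁ ^ m * (m : ℝ) ^ m) ∧
      ∀ (p : ℕ), p.Prime → P p → ∀ (m : ℕ) (α : Fin m → ℚ) (b : Fin m → ℤ) (V : Fin m → ℝ)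
        (Vmax W : ℝ),
        (∀ j, α j ≠ 0 ∧ padicValRat p (α j) = 0) →
        (∀ μ : Fin m → ℤ, ∏ j, α j ^ μ j = 1 → μ = 0) →
        (∀ T : Finset (Fin m), T.Nonempty → ¬ IsSquare (∏ j ∈ T, α j) ∧ ¬ IsSquare (-∏ j ∈ T, α j)) →
        (∀ j, Height.logHeight₁ (α j) ≤ V j) → (∀ j, Real.log p ≤ V j) → (∀ j, V j ≤ Vmax) →
        b ≠ 0 → (∀ j, Real.log (max 3 (|b j| : ℝ)) ≤ W) → Real.log p ≤ W →
        (padicValRat p (∏ j, α j ^ b j - 1) : ℝ) ≤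
          C m * p * (∏ j, V j / Real.log p) * (W + Real.log (2 * Vmax)) * Real.log (2 * Vmax)) :
    ∃ c₅ : ℝ, ∀ (p : ℕ), p.Prime → P p → ∀ (S : Finset ℕ), (∀ q ∈ S, q.Prime) → p ∉ S →
      S.Nonempty → ∀ (e : ℕ → ℤ) (B : ℝ), 3 ≤ B → (∀ q ∈ S, (|e q| : ℝ) ≤ B) →
      ∏ q ∈ S, (q : ℚ) ^ e q ≠ 1 →
      (padicValRat p (∏ q ∈ S, (q : ℚ) ^ e q - 1) : ℝ) <
        (c₅ * S.card) ^ S.card * (p : ℝ) ^ 2 *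
          ((Real.log B + Real.log (Real.log ((max 4 (S.sup id) : ℕ) : ℝ))) *
            Real.log (Real.log ((max 4 (S.sup id) : ℕ) : ℝ))) *
          ∏ q ∈ S, Real.log ((max 4 q : ℕ) : ℝ) := by
  classical
  obtain ⟨C, c₁, hc₁, hC, hA⟩ := hE
  refine ⟨41 * c₁, ?_⟩
  intro p hp hPp S hS hpS hSne e B hB heB hne1
  have hp2 : p ≠ 2 := fun h => hP2 (h ▸ hPp)
  haveI := Fact.mk hp
  -- enumeration of `S`
  set m : ℕ := S.card with hm
  have hm1 : 1 ≤ m := Finset.card_pos.mpr hSne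
  set φ : Fin m ≃ S := S.equivFin.symm with hφ
  set q : Fin m → ℕ := fun i => (φ i : ℕ) with hqdef
  have hqS : ∀ i, q i ∈ S := fun i => (φ i).2
  have hqP : ∀ i, (q i).Prime := fun i => hS _ (hqS i)
  have hinj : Function.Injective q := fun i j hij => φ.injective (Subtype.ext hij)
  have hqp : ∀ i, q i ≠ p := fun i h => hpS (h ▸ hqS i)
  have hreidx : ∀ {M : Type} [CommMonoid M] (f : ℕ → M), ∏ i, f (q i) = ∏ x ∈ S, f x := by
    intro M _ f
    rw [← Finset.prod_coe_sort S f]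
    exact Fintype.prod_equiv φ (fun i => f (q i)) (fun x => f x) (fun i => rfl)
  -- the data fed to the engine
  set L : ℝ := Real.log p with hL
  set M4 : ℝ := ((max 4 (S.sup id) : ℕ) : ℝ) with hM4
  set X : ℝ := Real.log M4 with hX
  set α : Fin m → ℚ := fun j => (q j : ℚ) with hα
  set b : Fin m → ℤ := fun j => e (q j) with hb
  set V : Fin m → ℝ := fun j => L * Real.log ((max 4 (q j) : ℕ) : ℝ) with hV
  set Vmax : ℝ := L * X with hVmax
  set W : ℝ := Real.log B * L with hW
  -- numerics of `p ≥ 3`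
  have hp3 : 3 ≤ p := by have := hp.two_le; omega
  have hp3R : (3 : ℝ) ≤ p := by exact_mod_cast hp3
  have hpR0 : (0 : ℝ) < p := by linarith
  have hL1 : 1 < L := by
    have h3 : (1 : ℝ) < Real.log 3 := by
      rw [Real.lt_log_iff_exp_lt (by norm_num)]
      exact Real.exp_one_lt_d9.trans (by norm_num)
    exact h3.trans_le (Real.log_le_log (by norm_num) hp3R)
  have hL0 : 0 < L := by linarith
  have hX1 : (1.38 : ℝ) ≤ X := (loglog_max_four_bounds (S.sup id)).1
  have hℓ : (0.27 : ℝ) ≤ Real.log X := (loglog_max_four_bounds (S.sup id)).2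
  have hX0 : 0 < X := by linarith
  have hlogmax : ∀ j, (1.38 : ℝ) ≤ Real.log ((max 4 (q j) : ℕ) : ℝ) := fun j =>
    (loglog_max_four_bounds (q j)).1
  -- the engine's hypotheses
  have h1 : ∀ j, α j ≠ 0 ∧ padicValRat p (α j) = 0 := fun j =>
    ⟨by simp only [hα]; exact_mod_cast (hqP j).ne_zero,
      Literature.Barriers.ABC.StewartTijdemanGeneric.padicValRat_natCast_prime_of_ne hp (hqP j) (hqp j)⟩
  have h2 : ∀ μ : Fin m → ℤ, ∏ j, α j ^ μ j = 1 → μ = 0 := fun μ hμ =>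
    Literature.Barriers.ABC.StewartTijdemanGeneric.prime_family_zpow_eq_one hqP hinj hμ
  have h3 : ∀ T : Finset (Fin m), T.Nonempty →
      ¬ IsSquare (∏ j ∈ T, α j) ∧ ¬ IsSquare (-∏ j ∈ T, α j) := fun T hT =>
    not_isSquare_prod_distinct_primes q hqP hinj T hT
  have h4 : ∀ j, logHeight₁ (α j) ≤ V j := by
    intro j
    haveI : NeZero (q j) := ⟨(hqP j).ne_zero⟩
    have hh : logHeight₁ (α j) = Real.log (q j) := by
      simp only [hα]; exact Rat.logHeight₁_natCast (q j)
    rw [hh]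
    have hq4 : Real.log (q j) ≤ Real.log ((max 4 (q j) : ℕ) : ℝ) :=
      Real.log_le_log (by exact_mod_cast (hqP j).pos) (by exact_mod_cast le_max_right 4 (q j))
    calc Real.log (q j) ≤ Real.log ((max 4 (q j) : ℕ) : ℝ) := hq4
      _ ≤ L * Real.log ((max 4 (q j) : ℕ) : ℝ) :=
          le_mul_of_one_le_left (by linarith [hlogmax j]) hL1.le
  have h5 : ∀ j, Real.log p ≤ V j := fun j => by
    show L ≤ L * Real.log ((max 4 (q j) : ℕ) : ℝ)
    exact le_mul_of_one_le_right hL0.le (by linarith [hlogmax j])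
  have h6 : ∀ j, V j ≤ Vmax := by
    intro j
    have hle : ((max 4 (q j) : ℕ) : ℝ) ≤ M4 := by
      rw [hM4]
      exact_mod_cast max_le_max le_rfl (Finset.le_sup (f := id) (hqS j))
    have hpos : (0 : ℝ) < ((max 4 (q j) : ℕ) : ℝ) := by
      exact_mod_cast lt_of_lt_of_le (by norm_num) (le_max_left 4 (q j))
    exact mul_le_mul_of_nonneg_left (Real.log_le_log hpos hle) hL0.le
  have hprodQ : ∏ j, α j ^ b j = ∏ x ∈ S, (x : ℚ) ^ e x := hreidx (fun x => (x : ℚ) ^ e x)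
  have h7 : b ≠ 0 := by
    intro h0
    apply hne1
    rw [← hprodQ]
    exact Finset.prod_eq_one fun j _ => by rw [show b j = 0 from congrFun h0 j, zpow_zero]
  have hB0 : 0 < Real.log B := Real.log_pos (by linarith)
  have hB1 : 1 ≤ Real.log B := by
    have h3 : (1 : ℝ) < Real.log 3 := by
      rw [Real.lt_log_iff_exp_lt (by norm_num)]
      exact Real.exp_one_lt_d9.trans (by norm_num)
    exact h3.le.trans (Real.log_le_log (by norm_num) hB)
  have hWge : Real.log B ≤ W := by
    rw [hW]; exact le_mul_of_one_le_right hB0.le hL1.le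
  have h8 : ∀ j, Real.log (max 3 (|b j| : ℝ)) ≤ W := by
    intro j
    have hle : max 3 (|b j| : ℝ) ≤ B := max_le hB (by simp only [hb]; exact heB _ (hqS j))
    exact (Real.log_le_log (lt_of_lt_of_le (by norm_num) (le_max_left _ _)) hle).trans hWge
  have h9 : Real.log p ≤ W := by
    rw [hW, ← hL]; exact le_mul_of_one_le_left hL0.le hB1
  -- the engine
  have key := hA p hp hPp m α b V Vmax W h1 h2 h3 h4 h5 h6 h7 h8 h9
  rw [hprodQ] at key
  -- `∏ Vⱼ / log p = ∏_{q ∈ S} log (max 4 q)`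
  set PL : ℝ := ∏ x ∈ S, Real.log ((max 4 x : ℕ) : ℝ) with hPL
  have hPV : ∏ j, V j / Real.log p = PL := by
    rw [hPL, ← hreidx (fun x => Real.log ((max 4 x : ℕ) : ℝ))]
    refine Finset.prod_congr rfl fun j _ => ?_
    simp only [hV]
    rw [← hL]
    field_simp
  have hPL0 : 0 < PL := Finset.prod_pos fun x _ => by
    linarith [(loglog_max_four_bounds x).1]
  have hW0 : 0 < W := by rw [hW]; exact mul_pos hB0 hL0
  have hlX0 : 0 < Real.log X := by linarith
  -- the garbage: `log(2Vmax) ≤ L(1 + log X)` and `W + log(2Vmax) ≤ 2L(log B + log X)`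
  have hVmax0 : 0 < Vmax := by rw [hVmax]; exact mul_pos hL0 hX0
  have hlog2V : Real.log (2 * Vmax) ≤ L + Real.log X := by
    rw [hVmax, show 2 * (L * X) = 2 * L * X by ring, Real.log_mul (by positivity) hX0.ne',
      Real.log_mul (by norm_num) hL0.ne']
    have hlogL : Real.log L ≤ L - 1 := Real.log_le_sub_one_of_pos hL0
    have hlog2 : Real.log 2 ≤ 1 := by have := Real.log_two_lt_d9; linarith
    linarith
  have hlog2V0 : 0 ≤ Real.log (2 * Vmax) := by
    apply Real.log_nonneg
    rw [hVmax]
    have : (1 : ℝ) ≤ L * X := by nlinarith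
    linarith
  have hG1 : Real.log (2 * Vmax) ≤ L * (1 + Real.log X) := by
    have : L + Real.log X ≤ L * (1 + Real.log X) := by nlinarith
    exact hlog2V.trans this
  have hG2 : W + Real.log (2 * Vmax) ≤ 2 * L * (Real.log B + Real.log X) := by
    rw [hW]
    have : Real.log B * L + (L + Real.log X) ≤ 2 * L * (Real.log B + Real.log X) := by nlinarith
    linarith
  have hG3 : 1 + Real.log X ≤ 5 * Real.log X := by linarith
  have hgarb : (W + Real.log (2 * Vmax)) * Real.log (2 * Vmax) ≤
      10 * L ^ 2 * ((Real.log B + Real.log X) * Real.log X) := by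
    have h01 : 0 ≤ W + Real.log (2 * Vmax) := by linarith
    calc (W + Real.log (2 * Vmax)) * Real.log (2 * Vmax)
        ≤ (2 * L * (Real.log B + Real.log X)) * (L * (1 + Real.log X)) :=
          mul_le_mul hG2 hG1 hlog2V0 (by positivity)
      _ ≤ (2 * L * (Real.log B + Real.log X)) * (L * (5 * Real.log X)) := by
          apply mul_le_mul_of_nonneg_left _ (by positivity)
          exact mul_le_mul_of_nonneg_left hG3 hL0.le
      _ = 10 * L ^ 2 * ((Real.log B + Real.log X) * Real.log X) := by ring
  have hL2p : L ^ 2 ≤ 4 * (p : ℝ) := by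
    rw [hL]; exact Literature.NumberTheory.Transcendental.log_sq_le_four_mul (by linarith)
  -- assemble: `v ≤ C p PL (W+L2V) L2V ≤ C p PL 10 L² Q ≤ 40 C p² PL Q < (41 c₁ m)^m p² Q PL`
  set Q : ℝ := (Real.log B + Real.log X) * Real.log X with hQ
  have hQ0 : 0 < Q := by rw [hQ]; exact mul_pos (by linarith) hlX0
  set v : ℝ := (padicValRat p (∏ x ∈ S, (x : ℚ) ^ e x - 1) : ℝ) with hv
  have hCm := hC m
  have hstep1 : v ≤ C m * p * PL * (10 * L ^ 2 * Q) := by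
    have h0 : 0 ≤ C m * p * PL := mul_nonneg (mul_nonneg hCm.1 hpR0.le) hPL0.le
    calc v ≤ C m * p * (∏ j, V j / Real.log p) * (W + Real.log (2 * Vmax)) * Real.log (2 * Vmax) := key
      _ = C m * p * PL * ((W + Real.log (2 * Vmax)) * Real.log (2 * Vmax)) := by rw [hPV]; ring
      _ ≤ C m * p * PL * (10 * L ^ 2 * Q) := mul_le_mul_of_nonneg_left hgarb h0
  have hstep2 : C m * p * PL * (10 * L ^ 2 * Q) ≤ 40 * (c₁ ^ m * (m : ℝ) ^ m) * ((p : ℝ) ^ 2 * Q * PL) := by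
    have h1 : C m * p * PL * (10 * L ^ 2 * Q) = (C m) * (L ^ 2) * (10 * p * Q * PL) := by ring
    have h2 : 40 * (c₁ ^ m * (m : ℝ) ^ m) * ((p : ℝ) ^ 2 * Q * PL) =
        (c₁ ^ m * (m : ℝ) ^ m) * (4 * p) * (10 * p * Q * PL) := by ring
    rw [h1, h2]
    have h0 : 0 ≤ 10 * (p : ℝ) * Q * PL := by positivity
    exact mul_le_mul_of_nonneg_right (mul_le_mul hCm.2 hL2p (by positivity) (by positivity)) h0
  have henv : 40 * (c₁ ^ m * (m : ℝ) ^ m) < (41 * c₁ * m) ^ m := by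
    have hm0 : (0 : ℝ) < (m : ℝ) ^ m := by
      have : (0 : ℝ) < m := by exact_mod_cast hm1
      positivity
    have hc0 : 0 < c₁ ^ m := by positivity
    have h41 : (40 : ℝ) < 41 ^ m := by
      calc (40 : ℝ) < 41 := by norm_num
        _ = 41 ^ 1 := (pow_one _).symm
        _ ≤ 41 ^ m := pow_le_pow_right₀ (by norm_num) hm1
    calc 40 * (c₁ ^ m * (m : ℝ) ^ m) < 41 ^ m * (c₁ ^ m * (m : ℝ) ^ m) :=
          mul_lt_mul_of_pos_right h41 (mul_pos hc0 hm0)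
      _ = (41 * c₁ * m) ^ m := by rw [mul_pow, mul_pow]; ring
  calc v ≤ C m * p * PL * (10 * L ^ 2 * Q) := hstep1
    _ ≤ 40 * (c₁ ^ m * (m : ℝ) ^ m) * ((p : ℝ) ^ 2 * Q * PL) := hstep2
    _ < (41 * c₁ * m) ^ m * ((p : ℝ) ^ 2 * Q * PL) :=
        mul_lt_mul_of_pos_right henv (mul_pos (mul_pos (pow_pos hpR0 2) hQ0) hPL0)
    _ = (41 * c₁ * m) ^ m * (p : ℝ) ^ 2 * Q * PL := by ring

/-- The Waldschmidt-shape text at `p ≡ 3 (mod 4)` from the Waldschmidt-shape engine there. [folklore] -/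
theorem threeModFour_of_w80Engine
    (hE : ∃ (C : ℕ → ℝ) (c₁ : ℝ), 1 ≤ c₁ ∧ (∀ m, 0 ≤ C m ∧ C m ≤ c₁ ^ m * (m : ℝ) ^ m) ∧
      ∀ (p : ℕ), p.Prime → p % 4 = 3 → ∀ (m : ℕ) (α : Fin m → ℚ) (b : Fin m → ℤ) (V : Fin m → ℝ)
        (Vmax W : ℝ),
        (∀ j, α j ≠ 0 ∧ padicValRat p (α j) = 0) →
        (∀ μ : Fin m → ℤ, ∏ j, α j ^ μ j = 1 → μ = 0) →
        (∀ T : Finset (Fin m), T.Nonempty → ¬ IsSquare (∏ j ∈ T, α j) ∧ ¬ IsSquare (-∏ j ∈ T, α j)) →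
        (∀ j, Height.logHeight₁ (α j) ≤ V j) → (∀ j, Real.log p ≤ V j) → (∀ j, V j ≤ Vmax) →
        b ≠ 0 → (∀ j, Real.log (max 3 (|b j| : ℝ)) ≤ W) → Real.log p ≤ W →
        (padicValRat p (∏ j, α j ^ b j - 1) : ℝ) ≤
          C m * p * (∏ j, V j / Real.log p) * (W + Real.log (2 * Vmax)) * Real.log (2 * Vmax)) :
    ∃ c₅ : ℝ, ∀ (p : ℕ), p.Prime → p % 4 = 3 → ∀ (S : Finset ℕ), (∀ q ∈ S, q.Prime) → p ∉ S →
      S.Nonempty → ∀ (e : ℕ → ℤ) (B : ℝ), 3 ≤ B → (∀ q ∈ S, (|e q| : ℝ) ≤ B) →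
      ∏ q ∈ S, (q : ℚ) ^ e q ≠ 1 →
      (padicValRat p (∏ q ∈ S, (q : ℚ) ^ e q - 1) : ℝ) <
        (c₅ * S.card) ^ S.card * (p : ℝ) ^ 2 *
          ((Real.log B + Real.log (Real.log ((max 4 (S.sup id) : ℕ) : ℝ))) *
            Real.log (Real.log ((max 4 (S.sup id) : ℕ) : ℝ))) *
          ∏ q ∈ S, Real.log ((max 4 q : ℕ) : ℝ) :=
  residueClass_of_w80Engine (fun p => p % 4 = 3) (by norm_num) hE

/-- The Waldschmidt-shape text at `p ≡ 1 (mod 4)` from the Waldschmidt-shape engine there. [folklore] -/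
theorem oneModFour_of_w80Engine
    (hE : ∃ (C : ℕ → ℝ) (c₁ : ℝ), 1 ≤ c₁ ∧ (∀ m, 0 ≤ C m ∧ C m ≤ c₁ ^ m * (m : ℝ) ^ m) ∧
      ∀ (p : ℕ), p.Prime → p % 4 = 1 → ∀ (m : ℕ) (α : Fin m → ℚ) (b : Fin m → ℤ) (V : Fin m → ℝ)
        (Vmax W : ℝ),
        (∀ j, α j ≠ 0 ∧ padicValRat p (α j) = 0) →
        (∀ μ : Fin m → ℤ, ∏ j, α j ^ μ j = 1 → μ = 0) →
        (∀ T : Finset (Fin m), T.Nonempty → ¬ IsSquare (∏ j ∈ T, α j) ∧ ¬ IsSquare (-∏ j ∈ T, α j)) →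
        (∀ j, Height.logHeight₁ (α j) ≤ V j) → (∀ j, Real.log p ≤ V j) → (∀ j, V j ≤ Vmax) →
        b ≠ 0 → (∀ j, Real.log (max 3 (|b j| : ℝ)) ≤ W) → Real.log p ≤ W →
        (padicValRat p (∏ j, α j ^ b j - 1) : ℝ) ≤
          C m * p * (∏ j, V j / Real.log p) * (W + Real.log (2 * Vmax)) * Real.log (2 * Vmax)) :
    ∃ c₅ : ℝ, ∀ (p : ℕ), p.Prime → p % 4 = 1 → ∀ (S : Finset ℕ), (∀ q ∈ S, q.Prime) → p ∉ S →
      S.Nonempty → ∀ (e : ℕ → ℤ) (B : ℝ), 3 ≤ B → (∀ q ∈ S, (|e q| : ℝ) ≤ B) →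
      ∏ q ∈ S, (q : ℚ) ^ e q ≠ 1 →
      (padicValRat p (∏ q ∈ S, (q : ℚ) ^ e q - 1) : ℝ) <
        (c₅ * S.card) ^ S.card * (p : ℝ) ^ 2 *
          ((Real.log B + Real.log (Real.log ((max 4 (S.sup id) : ℕ) : ℝ))) *
            Real.log (Real.log ((max 4 (S.sup id) : ℕ) : ℝ))) *
          ∏ q ∈ S, Real.log ((max 4 q : ℕ) : ℝ) :=
  residueClass_of_w80Engine (fun p => p % 4 = 1) (by norm_num) hE

/-- The Waldschmidt-shape text at every ODD prime from the ODD Waldschmidt-shape engine (memo-03: one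
engine for all odd `p`). [folklore] -/
theorem odd_of_w80Engine
    (hE : ∃ (C : ℕ → ℝ) (c₁ : ℝ), 1 ≤ c₁ ∧ (∀ m, 0 ≤ C m ∧ C m ≤ c₁ ^ m * (m : ℝ) ^ m) ∧
      ∀ (p : ℕ), p.Prime → p ≠ 2 → ∀ (m : ℕ) (α : Fin m → ℚ) (b : Fin m → ℤ) (V : Fin m → ℝ)
        (Vmax W : ℝ),
        (∀ j, α j ≠ 0 ∧ padicValRat p (α j) = 0) →
        (∀ μ : Fin m → ℤ, ∏ j, α j ^ μ j = 1 → μ = 0) →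
        (∀ T : Finset (Fin m), T.Nonempty → ¬ IsSquare (∏ j ∈ T, α j) ∧ ¬ IsSquare (-∏ j ∈ T, α j)) →
        (∀ j, Height.logHeight₁ (α j) ≤ V j) → (∀ j, Real.log p ≤ V j) → (∀ j, V j ≤ Vmax) →
        b ≠ 0 → (∀ j, Real.log (max 3 (|b j| : ℝ)) ≤ W) → Real.log p ≤ W →
        (padicValRat p (∏ j, α j ^ b j - 1) : ℝ) ≤
          C m * p * (∏ j, V j / Real.log p) * (W + Real.log (2 * Vmax)) * Real.log (2 * Vmax)) :
    ∃ c₅ : ℝ, ∀ (p : ℕ), p.Prime → p ≠ 2 → ∀ (S : Finset ℕ), (∀ q ∈ S, q.Prime) → p ∉ S →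
      S.Nonempty → ∀ (e : ℕ → ℤ) (B : ℝ), 3 ≤ B → (∀ q ∈ S, (|e q| : ℝ) ≤ B) →
      ∏ q ∈ S, (q : ℚ) ^ e q ≠ 1 →
      (padicValRat p (∏ q ∈ S, (q : ℚ) ^ e q - 1) : ℝ) <
        (c₅ * S.card) ^ S.card * (p : ℝ) ^ 2 *
          ((Real.log B + Real.log (Real.log ((max 4 (S.sup id) : ℕ) : ℝ))) *
            Real.log (Real.log ((max 4 (S.sup id) : ℕ) : ℝ))) *
          ∏ q ∈ S, Real.log ((max 4 q : ℕ) : ℝ) :=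
  residueClass_of_w80Engine (fun p => p ≠ 2) (by norm_num) hE

end YuNinetyW80

end Summit.ABC.StewartYu

end
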